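import Summits.Ventures.PercRepro.RankLevelSetBiIndepContainSkewParallel
import Summits.Ventures.PercRepro.RankLevelSetMinorPairProfile

/-! # RankLevelSetBiIndepContainNormParallel — (CUM-norm) IS DECIDED ON SIMPLE MATROIDS: IT TRANSFERS THROUGH A
PARALLEL PAIR, AND A LOOP MAKES IT VACUOUS (night-1 g30; dossier §42.20)

For a parallel pair `{y, z}` of `M` and `N = M ／ {y} ＼ {z}` (two fewer elements, rank one less; g25/g30):
`α^X_{r+1}(M) = α^{X∖y}_r(N)` for `y ∈ X ∌ z` (and symmetrically), `= 0` when `X ⊇ {y, z}`, and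
`α^X_{r+1}(M) = 2·α^X_r(N)` for `X` avoiding the pair (g30's `biContainCount_parallel_*`). In the first case the
normalization is identical (`#E − 2#X = #E(N) − 2#(X ∖ y)`) and (CUM-norm) is inherited verbatim; in the last the
normalizations differ by `C(N', j) · j (N' − j) = C(N' − 2, j − 1) · N'(N' − 1)` (**`choose_mul_eq_choose_sub_two`**),
and the factor `j (N' − j)` is nondecreasing on the required pairs (`i < j`, `i + j ≤ N'`), so (CUM-norm) of `N` at
`(i − 1, j − 1)` gives (CUM-norm) of `M` at `(i, j)` (**`biContainNormSkew_of_parallel'`**, unfolded form). A loop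
empties every contain profile (g30's `biContainCount_eq_zero_of_loop`), so (CUM-norm) holds (**`biContainNormSkew_of_loop'`**).
Together with the vacuity on fewer than two elements: (CUM-norm) for every matroid follows from (CUM-norm) for every
SIMPLE matroid. Every declaration has a docstring; imports: the cell's own modules and Mathlib only. Axioms: standard. -/

namespace PercRepro

open Set Matroid

variable {α : Type} (M : Matroid α) [M.Finite]

omit [M.Finite] in
/-- **The two-step binomial identity**: `C(m + 2, t + 1) · (t + 1) · (m + 1 − t) = C(m, t) · (m + 2) · (m + 1)`. -/
lemma choose_mul_eq_choose_sub_two (m t : ℕ) :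
    (m + 1 + 1).choose (t + 1) * (t + 1) * (m + 1 - t) = m.choose t * (m + 1 + 1) * (m + 1) := by
  have h1 := Nat.add_one_mul_choose_eq (m + 1) t
  have h2 := Nat.choose_mul_succ_eq m t
  calc (m + 1 + 1).choose (t + 1) * (t + 1) * (m + 1 - t)
      = ((m + 1 + 1) * (m + 1).choose t) * (m + 1 - t) := by rw [h1]
    _ = (m + 1 + 1) * ((m + 1).choose t * (m + 1 - t)) := by ring
    _ = (m + 1 + 1) * (m.choose t * (m + 1)) := by rw [← h2]
    _ = m.choose t * (m + 1 + 1) * (m + 1) := by ring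

/-- **(CUM-norm) transfers through a parallel pair** (unfolded form): if `N = M ／ {y} ＼ {z}` satisfies it, so does
`M`. -/
theorem biContainNormSkew_of_parallel' {y z : α} (h : ParallelPair M y z)
    (hN : ∀ X ⊆ (M ／ {y} ＼ {z}).E, ∀ i j : ℕ, i < j → i + j + 1 ≤ (M ／ {y} ＼ {z}).E.ncard - 2 * X.ncard →
      biContainCount (M ／ {y} ＼ {z}) X (X.ncard + i) * ((M ／ {y} ＼ {z}).E.ncard - 2 * X.ncard).choose j ≤
        biContainCount (M ／ {y} ＼ {z}) X (X.ncard + j) * ((M ／ {y} ＼ {z}).E.ncard - 2 * X.ncard).choose i) :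
    ∀ X ⊆ M.E, ∀ i j : ℕ, i < j → i + j + 1 ≤ M.E.ncard - 2 * X.ncard →
      biContainCount M X (X.ncard + i) * (M.E.ncard - 2 * X.ncard).choose j ≤
        biContainCount M X (X.ncard + j) * (M.E.ncard - 2 * X.ncard).choose i := by
  intro X hX i j hij hR
  have hn := ncard_ground_contract_delete M h
  have hn2 := two_le_ncard_of_parallel M h
  have hXfin : X.Finite := M.ground_finite.subset hX
  by_cases hyX : y ∈ X <;> by_cases hzX : z ∈ X
  · rw [biContainCount_parallel_both M h hyX hzX, Nat.zero_mul]
    exact Nat.zero_le _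
  · -- `y ∈ X`, `z ∉ X`: the profile of `N` at `X ∖ {y}`, same normalization
    have hX' : X \ {y} ⊆ (M ／ {y} ＼ {z}).E := sdiff_subset_ground_contract_delete (M := M) (y := y) (z := z) hX hzX
    have hc : (X \ {y}).ncard = X.ncard - 1 := Set.ncard_sdiff_singleton_of_mem hyX
    have hc1 : 0 < X.ncard := (Set.ncard_pos hXfin).mpr ⟨y, hyX⟩
    have e1 : X.ncard + i = (X.ncard - 1 + i) + 1 := by omega
    have e2 : X.ncard + j = (X.ncard - 1 + j) + 1 := by omega
    rw [e1, e2, biContainCount_parallel_mem_left M h hyX, biContainCount_parallel_mem_left M h hyX]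
    have := hN (X \ {y}) hX' i j hij (by rw [hn, hc]; omega)
    rw [hn, hc] at this
    have e3 : M.E.ncard - 2 - 2 * (X.ncard - 1) = M.E.ncard - 2 * X.ncard := by omega
    rw [e3] at this
    exact this
  · -- `z ∈ X`, `y ∉ X`: symmetric
    have hX' : X \ {z} ⊆ (M ／ {y} ＼ {z}).E := by
      have := sdiff_subset_ground_contract_delete (M := M) (y := z) (z := y) hX hyX
      rwa [ground_contract_delete, Set.pair_comm, ← ground_contract_delete] at this
    have hc : (X \ {z}).ncard = X.ncard - 1 := Set.ncard_sdiff_singleton_of_mem hzX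
    have hc1 : 0 < X.ncard := (Set.ncard_pos hXfin).mpr ⟨z, hzX⟩
    have e1 : X.ncard + i = (X.ncard - 1 + i) + 1 := by omega
    have e2 : X.ncard + j = (X.ncard - 1 + j) + 1 := by omega
    rw [e1, e2, biContainCount_parallel_mem_right M h hzX, biContainCount_parallel_mem_right M h hzX]
    have := hN (X \ {z}) hX' i j hij (by rw [hn, hc]; omega)
    rw [hn, hc] at this
    have e3 : M.E.ncard - 2 - 2 * (X.ncard - 1) = M.E.ncard - 2 * X.ncard := by omega
    rw [e3] at this
    exact this
  · -- neither: `α^X_{r+1}(M) = 2 α^X_r(N)`, normalizations two apart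
    have hX' : X ⊆ (M ／ {y} ＼ {z}).E := by
      rw [ground_contract_delete]
      intro x hx
      refine ⟨hX hx, ?_⟩
      simp only [Set.mem_insert_iff, Set.mem_singleton_iff, not_or]
      exact ⟨fun hxy => hyX (hxy ▸ hx), fun hxz => hzX (hxz ▸ hx)⟩
    rcases Nat.eq_zero_or_pos (X.ncard + i) with h0 | hpos
    · rw [h0, biContainCount_parallel_zero M h X, Nat.zero_mul]
      exact Nat.zero_le _
    rcases Nat.eq_zero_or_pos i with hi0 | hi1
    · -- `i = 0`, `#X ≥ 1`: the level `#X − 1` of `N` is empty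
      subst hi0
      have e1 : X.ncard + 0 = (X.ncard - 1) + 1 := by omega
      rw [e1, biContainCount_parallel_notMem M h hyX hzX, biContainCount_eq_zero_of_lt_ncard _ (by omega)]
      simp
    -- `i ≥ 1`: use `N` at `(i − 1, j − 1)`
    set N' := M.E.ncard - 2 * X.ncard with hN'
    have e1 : X.ncard + i = (X.ncard + (i - 1)) + 1 := by omega
    have e2 : X.ncard + j = (X.ncard + (j - 1)) + 1 := by omega
    rw [e1, e2, biContainCount_parallel_notMem M h hyX hzX, biContainCount_parallel_notMem M h hyX hzX]
    have hNj := hN X hX' (i - 1) (j - 1) (by omega) (by rw [hn]; omega)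
    rw [hn] at hNj
    have e3 : M.E.ncard - 2 - 2 * X.ncard = N' - 2 := by omega
    rw [e3] at hNj
    -- binomial identities at `i` and `j` (`N' = m + 2`, `i = t + 1`)
    obtain ⟨m, hm⟩ : ∃ m, N' = m + 1 + 1 := ⟨N' - 2, by omega⟩
    obtain ⟨ti, hti⟩ : ∃ t, i = t + 1 := ⟨i - 1, by omega⟩
    obtain ⟨tj, htj⟩ : ∃ t, j = t + 1 := ⟨j - 1, by omega⟩
    have hi' := choose_mul_eq_choose_sub_two m ti
    have hj' := choose_mul_eq_choose_sub_two m tj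
    rw [hm, hti, htj] at hNj ⊢
    simp only [Nat.add_sub_cancel] at hNj ⊢
    -- the factor `t (N' − t)` is nondecreasing on the required pairs
    have hfac : (ti + 1) * (m + 1 - ti) ≤ (tj + 1) * (m + 1 - tj) := by
      have h1 : ti < tj := by omega
      have h2 : ti + tj + 2 ≤ m + 1 := by omega
      rcases Nat.lt_or_ge (m + 1) tj with hlt | hge
      · omega
      · nlinarith [Nat.sub_add_cancel hge, Nat.sub_add_cancel (show ti ≤ m + 1 by omega)]
    -- multiply `hNj` through
    have hpos' : 0 < (ti + 1) * (m + 1 - ti) := Nat.mul_pos (Nat.succ_pos _) (by omega)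
    set A := biContainCount (M ／ {y} ＼ {z}) X (X.ncard + ti) with hA
    set B := biContainCount (M ／ {y} ＼ {z}) X (X.ncard + tj) with hB
    refine Nat.le_of_mul_le_mul_right (c := (ti + 1) * (m + 1 - ti)) ?_ hpos'
    calc 2 * A * (m + 1 + 1).choose (tj + 1) * ((ti + 1) * (m + 1 - ti))
        ≤ 2 * A * (m + 1 + 1).choose (tj + 1) * ((tj + 1) * (m + 1 - tj)) := Nat.mul_le_mul_left _ hfac
      _ = 2 * A * (m.choose tj * (m + 1 + 1) * (m + 1)) := by rw [← hj']; ring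
      _ = 2 * (A * m.choose tj) * ((m + 1 + 1) * (m + 1)) := by ring
      _ ≤ 2 * (B * m.choose ti) * ((m + 1 + 1) * (m + 1)) := by
          apply Nat.mul_le_mul_right
          apply Nat.mul_le_mul_left
          exact hNj
      _ = 2 * B * (m.choose ti * (m + 1 + 1) * (m + 1)) := by ring
      _ = 2 * B * (m + 1 + 1).choose (ti + 1) * ((ti + 1) * (m + 1 - ti)) := by rw [← hi']; ring

omit [M.Finite] in
/-- **A loop makes (CUM-norm) vacuous** (unfolded form): every contain profile vanishes. -/
theorem biContainNormSkew_of_loop' {ℓ : α} (hℓE : ℓ ∈ M.E) (hℓ : ¬ M.Indep {ℓ}) :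
    ∀ X ⊆ M.E, ∀ i j : ℕ, i < j → i + j + 1 ≤ M.E.ncard - 2 * X.ncard →
      biContainCount M X (X.ncard + i) * (M.E.ncard - 2 * X.ncard).choose j ≤
        biContainCount M X (X.ncard + j) * (M.E.ncard - 2 * X.ncard).choose i := by
  intro X _ i j _ _
  rw [biContainCount_eq_zero_of_loop M hℓE hℓ, Nat.zero_mul]
  exact Nat.zero_le _

end PercRepro
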